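import Mathlib

/-!
# Crux `TiltedFlatness` (K3 of `PauliWegnerSea`), negative side — the exponent of the 1-D engine

Support file of the standing disprover (gen 2) of item stmt-QuantumFields-14070, written against the
picked line `circle-transport` (skeleton r2b, stub `stub_circleEngine`, second conjunct
`CircleSmallBall`: mean-relative small balls `|{t ∈ [-π,π] : f t ≤ ε ⨍ f}| ≤ C ε^c` for non-negative
trigonometric polynomials of degree `≤ D`).

**Theorem `not_circleSmallBall_exponent_gt`.**  For every `D ≥ 1` the engine CANNOT hold with an
exponent `c > 1/(2D)`: the witness `f = (1 - cos t)^D ≤ (t²/2)^D` has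
`{f ≤ ε ⨍ f} ⊇ [-ρ, ρ]`, `ρ = √2 (ε ⨍ f)^{1/(2D)}`, of length `2ρ ≫ C ε^c` as `ε → 0`.
So the exponent of `CircleSmallBall` is at best `1/(2D)` (`D = 8N_f` or `48N_f` downstream): the
engine-level form of `not_tiltedFlatness_uniform_in_Nf` (`NfDependence.lean`), and the reason the
trunk's final loss `p = max(p₀/c, p₀)` grows linearly in `N_f`.

Helpers of independent use to the line's workers (all elementary, sorry-free):
`trigPoly_mul` / `trigPoly_pow` (products and powers of functions of the stub's literal shape
`∃ a : ℤ → ℂ, ∀ t, F t = Σ_{k ∈ Icc (-D) D} a k e^{ikt}` stay in that shape with degrees adding —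
exactly what `det diracMatrix = Π_f det D_W(m_f)` needs in `stub_bandLimit`), `one_sub_cos_trig`,
`one_sub_cos_pow_trig`, `integral_one_sub_cos_pow_pos`.  Standard material. [folklore]
-/

open MeasureTheory Set Real Finset

namespace Summit.QuantumFields.QCD.Theorems.TiltedFlatnessNegative

/-- Product of trigonometric polynomials of degrees `≤ D₁`, `≤ D₂` (in the literal shape of the line's stubs) is a
trigonometric polynomial of degree `≤ D₁ + D₂` (Cauchy product of the coefficient sequences). [folklore] -/
theorem trigPoly_mul {D₁ D₂ : ℕ} {F G : ℝ → ℂ}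
    (hF : ∃ a : ℤ → ℂ, ∀ t : ℝ, F t =
      ∑ k ∈ Finset.Icc (-(D₁ : ℤ)) D₁, a k * Complex.exp ((k : ℂ) * (t : ℂ) * Complex.I))
    (hG : ∃ b : ℤ → ℂ, ∀ t : ℝ, G t =
      ∑ k ∈ Finset.Icc (-(D₂ : ℤ)) D₂, b k * Complex.exp ((k : ℂ) * (t : ℂ) * Complex.I)) :
    ∃ c : ℤ → ℂ, ∀ t : ℝ, F t * G t =
      ∑ k ∈ Finset.Icc (-((D₁ + D₂ : ℕ) : ℤ)) ((D₁ + D₂ : ℕ) : ℤ),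
        c k * Complex.exp ((k : ℂ) * (t : ℂ) * Complex.I) := by
  obtain ⟨a, ha⟩ := hF
  obtain ⟨b, hb⟩ := hG
  refine ⟨fun k => ∑ j ∈ Finset.Icc (-(D₁ : ℤ)) D₁, ∑ l ∈ Finset.Icc (-(D₂ : ℤ)) D₂,
    if j + l = k then a j * b l else 0, fun t => ?_⟩
  set e : ℤ → ℂ := fun k => Complex.exp ((k : ℂ) * (t : ℂ) * Complex.I) with he
  have hee : ∀ j l : ℤ, e j * e l = e (j + l) := by
    intro j l
    simp only [he, ← Complex.exp_add]
    congr 1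
    push_cast
    ring
  rw [ha t, hb t, Finset.sum_mul_sum]
  symm
  calc ∑ k ∈ Finset.Icc (-((D₁ + D₂ : ℕ) : ℤ)) ((D₁ + D₂ : ℕ) : ℤ),
        (∑ j ∈ Finset.Icc (-(D₁ : ℤ)) D₁, ∑ l ∈ Finset.Icc (-(D₂ : ℤ)) D₂,
          if j + l = k then a j * b l else 0) * e k
      = ∑ k ∈ Finset.Icc (-((D₁ + D₂ : ℕ) : ℤ)) ((D₁ + D₂ : ℕ) : ℤ),
          ∑ j ∈ Finset.Icc (-(D₁ : ℤ)) D₁, ∑ l ∈ Finset.Icc (-(D₂ : ℤ)) D₂,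
            (if j + l = k then a j * b l * e k else 0) := by
        refine Finset.sum_congr rfl fun k _ => ?_
        rw [Finset.sum_mul]
        refine Finset.sum_congr rfl fun j _ => ?_
        rw [Finset.sum_mul]
        refine Finset.sum_congr rfl fun l _ => ?_
        split_ifs <;> simp
    _ = ∑ j ∈ Finset.Icc (-(D₁ : ℤ)) D₁, ∑ l ∈ Finset.Icc (-(D₂ : ℤ)) D₂,
          ∑ k ∈ Finset.Icc (-((D₁ + D₂ : ℕ) : ℤ)) ((D₁ + D₂ : ℕ) : ℤ),
            (if j + l = k then a j * b l * e k else 0) := by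
        rw [Finset.sum_comm]
        refine Finset.sum_congr rfl fun j _ => ?_
        rw [Finset.sum_comm]
    _ = ∑ j ∈ Finset.Icc (-(D₁ : ℤ)) D₁, ∑ l ∈ Finset.Icc (-(D₂ : ℤ)) D₂,
          a j * e j * (b l * e l) := by
        refine Finset.sum_congr rfl fun j hj => ?_
        refine Finset.sum_congr rfl fun l hl => ?_
        rw [Finset.sum_ite_eq]
        have hmem : j + l ∈ Finset.Icc (-((D₁ + D₂ : ℕ) : ℤ)) ((D₁ + D₂ : ℕ) : ℤ) := by
          rw [Finset.mem_Icc] at hj hl ⊢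
          push_cast
          omega
        rw [if_pos hmem, ← hee]
        ring

/-- Powers of a trigonometric polynomial of degree `≤ D` have degree `≤ n D`. [folklore] -/
theorem trigPoly_pow {D : ℕ} {F : ℝ → ℂ}
    (hF : ∃ a : ℤ → ℂ, ∀ t : ℝ, F t =
      ∑ k ∈ Finset.Icc (-(D : ℤ)) D, a k * Complex.exp ((k : ℂ) * (t : ℂ) * Complex.I)) (n : ℕ) :
    ∃ c : ℤ → ℂ, ∀ t : ℝ, F t ^ n =
      ∑ k ∈ Finset.Icc (-((n * D : ℕ) : ℤ)) ((n * D : ℕ) : ℤ),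
        c k * Complex.exp ((k : ℂ) * (t : ℂ) * Complex.I) := by
  induction n with
  | zero =>
    refine ⟨fun k => if k = 0 then 1 else 0, fun t => ?_⟩
    simp
  | succ n ih =>
    obtain ⟨c, hc⟩ := trigPoly_mul ih hF
    refine ⟨c, fun t => ?_⟩
    rw [pow_succ, hc t]
    congr 2 <;> push_cast <;> ring

/-- `1 - cos t = 1 - (e^{it} + e^{-it})/2` as a trigonometric polynomial of degree `1`. [folklore] -/
theorem one_sub_cos_trig :
    ∃ a : ℤ → ℂ, ∀ t : ℝ, (((1 - Real.cos t : ℝ)) : ℂ) =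
      ∑ k ∈ Finset.Icc (-(1 : ℕ) : ℤ) (1 : ℕ), a k * Complex.exp ((k : ℂ) * (t : ℂ) * Complex.I) := by
  refine ⟨fun k : ℤ => if k = 0 then (1 : ℂ) else -(1 / 2), fun t => ?_⟩
  have h : Finset.Icc (-(1 : ℕ) : ℤ) (1 : ℕ) = {-1, 0, 1} := by decide
  rw [h, Finset.sum_insert (by decide), Finset.sum_insert (by decide), Finset.sum_singleton]
  simp only [Complex.ofReal_sub, Complex.ofReal_one, Complex.ofReal_cos]
  rw [Complex.cos]
  push_cast
  simp only [zero_mul, Complex.exp_zero, neg_mul, one_mul]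
  ring

/-- `(1 - cos t)^D` as a trigonometric polynomial of degree `D`. [folklore] -/
theorem one_sub_cos_pow_trig (D : ℕ) :
    ∃ a : ℤ → ℂ, ∀ t : ℝ, ((((1 - Real.cos t) ^ D : ℝ)) : ℂ) =
      ∑ k ∈ Finset.Icc (-(D : ℤ)) D, a k * Complex.exp ((k : ℂ) * (t : ℂ) * Complex.I) := by
  obtain ⟨c, hc⟩ := trigPoly_pow (F := fun t => (((1 - Real.cos t : ℝ)) : ℂ)) (D := 1)
    (by simpa using one_sub_cos_trig) D
  refine ⟨c, fun t => ?_⟩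
  have := hc t
  simp only [mul_one] at this
  push_cast at this ⊢
  exact this

/-- `∫_{[-π,π]} (1 - cos t)^D dt > 0` (the integrand is continuous, non-negative and positive on `(0, π]`). [folklore] -/
theorem integral_one_sub_cos_pow_pos (D : ℕ) :
    0 < ∫ t in Set.Icc (-π) π, (1 - Real.cos t) ^ D := by
  have hcont : Continuous fun t : ℝ => (1 - Real.cos t) ^ D :=
    (continuous_const.sub Real.continuous_cos).pow D
  rw [setIntegral_pos_iff_support_of_nonneg_ae]
  · -- the support contains `(0, π]`
    have hsub : Set.Ioc 0 π ⊆ (Function.support fun t : ℝ => (1 - Real.cos t) ^ D) ∩ Set.Icc (-π) π := by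
      intro t ht
      refine ⟨?_, ⟨by linarith [ht.1, Real.pi_pos], ht.2⟩⟩
      rw [Function.mem_support]
      apply pow_ne_zero
      intro h0
      have hcos : Real.cos t = 1 := by linarith
      rw [Real.cos_eq_one_iff_of_lt_of_lt (by linarith [ht.1, Real.pi_pos]) (by linarith [ht.2, Real.pi_pos])]
        at hcos
      linarith [ht.1]
    calc (0 : ENNReal) < volume (Set.Ioc (0 : ℝ) π) := by
          rw [Real.volume_Ioc]; simpa using Real.pi_pos
      _ ≤ _ := measure_mono hsub
  · exact Filter.Eventually.of_forall fun t => pow_nonneg (sub_nonneg.2 (Real.cos_le_one t)) D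
  · exact hcont.integrableOn_Icc

/-- **The exponent of the one-variable engine must decay like `1/(2D)`.**  For every degree `D ≥ 1`
there are NO constants `C` and `c > 1/(2D)` such that every non-negative trigonometric polynomial `f`
of degree `≤ D` with positive mean satisfies `|{t ∈ [-π,π] : f t ≤ ε ⨍ f}| ≤ C ε^c` for all `ε > 0`:
the witness `f = (1 - cos)^D ≤ (t²/2)^D` has `{f ≤ ε⨍f} ⊇ [-ρ, ρ]` with `ρ = √2 (ε⨍f)^{1/(2D)}`.  So in
`CircleSmallBall` (line `circle-transport`, stub `stub_circleEngine`) `c ≤ 1/(2D)` is forced — with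
`D = 8 N_f` downstream, this is the engine-level form of `not_tiltedFlatness_uniform_in_Nf`. [folklore] -/
theorem not_circleSmallBall_exponent_gt (D : ℕ) (hD : 1 ≤ D) :
    ¬ (∃ C c : ℝ, 1 / (2 * (D : ℝ)) < c ∧ ∀ f : ℝ → ℝ,
        (∃ a : ℤ → ℂ, ∀ t : ℝ, ((f t : ℝ) : ℂ) =
          ∑ k ∈ Finset.Icc (-(D : ℤ)) D, a k * Complex.exp ((k : ℂ) * (t : ℂ) * Complex.I)) →
        (∀ t, 0 ≤ f t) → 0 < ∫ t in Set.Icc (-π) π, f t → ∀ ε : ℝ, 0 < ε →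
          volume {t ∈ Set.Icc (-π) π | f t ≤ ε * ((∫ s in Set.Icc (-π) π, f s) / (2 * π))} ≤
            ENNReal.ofReal (C * ε ^ c)) := by
  rintro ⟨C, c, hc, H⟩
  have hD0 : (0 : ℝ) < D := by exact_mod_cast hD
  have hDne : (D : ℝ) ≠ 0 := hD0.ne'
  set f : ℝ → ℝ := fun t => (1 - Real.cos t) ^ D with hf
  have hf_trig : ∃ a : ℤ → ℂ, ∀ t : ℝ, ((f t : ℝ) : ℂ) =
      ∑ k ∈ Finset.Icc (-(D : ℤ)) D, a k * Complex.exp ((k : ℂ) * (t : ℂ) * Complex.I) :=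
    one_sub_cos_pow_trig D
  have hf_nn : ∀ t, 0 ≤ f t := fun t => pow_nonneg (sub_nonneg.2 (Real.cos_le_one t)) D
  set m : ℝ := ∫ t in Set.Icc (-π) π, f t with hm
  have hm0 : 0 < m := integral_one_sub_cos_pow_pos D
  -- the mean and its `1/(2D)`-th root
  set μ₀ : ℝ := (m / (2 * π)) ^ (1 / (2 * (D : ℝ))) with hμ₀
  have hmean : 0 < m / (2 * π) := by positivity
  have hμ₀0 : 0 < μ₀ := Real.rpow_pos_of_pos hmean _
  -- the exponent gap
  set s : ℝ := c - 1 / (2 * (D : ℝ)) with hs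
  have hs0 : 0 < s := by rw [hs]; linarith
  -- the case `C ≤ 0` is absorbed below; choose `ε`
  set q : ℝ := Real.sqrt 2 * μ₀ / (max C 1) with hq
  have hC1 : 0 < max C 1 := lt_max_of_lt_right one_pos
  have hq0 : 0 < q := by positivity
  set ε : ℝ := min (min 1 (2 * π / m)) (q ^ (1 / s)) with hε
  have hε0 : 0 < ε := lt_min (lt_min one_pos (by positivity)) (Real.rpow_pos_of_pos hq0 _)
  have hε1 : ε ≤ 1 := (min_le_left _ _).trans (min_le_left _ _)
  have hε2 : ε ≤ 2 * π / m := (min_le_left _ _).trans (min_le_right _ _)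
  have hεs : ε ^ s ≤ q := by
    calc ε ^ s ≤ (q ^ (1 / s)) ^ s :=
          Real.rpow_le_rpow hε0.le (min_le_right _ _) hs0.le
      _ = q := by rw [← Real.rpow_mul hq0.le, one_div, inv_mul_cancel₀ hs0.ne', Real.rpow_one]
  -- the threshold `τ = ε ⨍ f ≤ 1`
  set τ : ℝ := ε * (m / (2 * π)) with hτ
  have hτ0 : 0 < τ := by positivity
  have hτ1 : τ ≤ 1 := by
    rw [hτ]
    calc ε * (m / (2 * π)) ≤ (2 * π / m) * (m / (2 * π)) := by gcongr
      _ = 1 := by field_simp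
  -- the radius `ρ = √2 τ^{1/(2D)}` and `ρ² = 2 τ^{1/D}`
  set ρ : ℝ := Real.sqrt 2 * τ ^ (1 / (2 * (D : ℝ))) with hρ
  have h2 : 0 < Real.sqrt 2 := Real.sqrt_pos.2 (by norm_num)
  have hρ0 : 0 < ρ := by positivity
  have hρsq : ρ ^ 2 = 2 * τ ^ (1 / (D : ℝ)) := by
    rw [hρ, mul_pow, Real.sq_sqrt (by norm_num : (0:ℝ) ≤ 2)]
    congr 1
    rw [← Real.rpow_natCast, ← Real.rpow_mul hτ0.le]
    congr 1
    push_cast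
    field_simp
  have hτD : (τ ^ (1 / (D : ℝ))) ^ D = τ := by
    rw [← Real.rpow_natCast, ← Real.rpow_mul hτ0.le, one_div, inv_mul_cancel₀ hDne, Real.rpow_one]
  have hτD1 : τ ^ (1 / (D : ℝ)) ≤ 1 := Real.rpow_le_one hτ0.le hτ1 (by positivity)
  have hρπ : ρ ≤ π := by
    have hρ2 : ρ ^ 2 ≤ 2 := by rw [hρsq]; linarith
    have h32 : Real.sqrt 2 < 3 / 2 := by
      rw [show (3 / 2 : ℝ) = Real.sqrt ((3/2)^2) by rw [Real.sqrt_sq (by norm_num)]]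
      exact Real.sqrt_lt_sqrt (by norm_num) (by norm_num)
    have : ρ ≤ Real.sqrt 2 := by
      rw [← Real.sqrt_sq hρ0.le]
      exact Real.sqrt_le_sqrt hρ2
    linarith [Real.pi_gt_three]
  -- the interval `[-ρ, ρ]` lies in the sublevel set
  have hsub : Set.Icc (-ρ) ρ ⊆ {t ∈ Set.Icc (-π) π | f t ≤ ε * (m / (2 * π))} := by
    intro t ht
    refine ⟨⟨by linarith [ht.1], by linarith [ht.2]⟩, ?_⟩
    have hcos := Real.one_sub_sq_div_two_le_cos (x := t)
    have ht2 : t ^ 2 ≤ ρ ^ 2 := by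
      have : |t| ≤ ρ := abs_le.2 ⟨ht.1, ht.2⟩
      nlinarith [abs_nonneg t, sq_abs t]
    have hhalf : t ^ 2 / 2 ≤ τ ^ (1 / (D : ℝ)) := by rw [hρsq] at ht2; linarith
    show (1 - Real.cos t) ^ D ≤ ε * (m / (2 * π))
    calc (1 - Real.cos t) ^ D ≤ (t ^ 2 / 2) ^ D :=
          pow_le_pow_left₀ (sub_nonneg.2 (Real.cos_le_one t)) (by linarith) D
      _ ≤ (τ ^ (1 / (D : ℝ))) ^ D := pow_le_pow_left₀ (by positivity) hhalf D
      _ = τ := hτD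
  have key := H f hf_trig hf_nn hm0 ε hε0
  have hmono := (measure_mono (μ := volume) hsub).trans key
  rw [Real.volume_Icc, ENNReal.ofReal_le_ofReal_iff'] at hmono
  have h2ρ : 2 * ρ ≤ C * ε ^ c := by
    rcases hmono with h | h
    · linarith
    · linarith
  -- `2ρ = 2√2 μ₀ ε^{1/(2D)}` while `C ε^c ≤ (max C 1) ε^s ε^{1/(2D)} ≤ √2 μ₀ ε^{1/(2D)}`
  have hε2D : 0 < ε ^ (1 / (2 * (D : ℝ))) := Real.rpow_pos_of_pos hε0 _
  have hρε : ρ = Real.sqrt 2 * μ₀ * ε ^ (1 / (2 * (D : ℝ))) := by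
    rw [hρ, hτ, hμ₀, Real.mul_rpow hε0.le hmean.le]
    ring
  have hsplit : ε ^ c = ε ^ s * ε ^ (1 / (2 * (D : ℝ))) := by
    rw [← Real.rpow_add hε0]; congr 1; rw [hs]; ring
  have hup : C * ε ^ c ≤ Real.sqrt 2 * μ₀ * ε ^ (1 / (2 * (D : ℝ))) := by
    rw [hsplit, ← mul_assoc]
    have h1 : C * ε ^ s ≤ max C 1 * ε ^ s :=
      mul_le_mul_of_nonneg_right (le_max_left _ _) (Real.rpow_nonneg hε0.le _)
    have h2' : max C 1 * ε ^ s ≤ Real.sqrt 2 * μ₀ := by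
      calc max C 1 * ε ^ s ≤ max C 1 * q := by gcongr
        _ = Real.sqrt 2 * μ₀ := by rw [hq]; field_simp
    exact mul_le_mul_of_nonneg_right (h1.trans h2') hε2D.le
  have hfin : 2 * ρ ≤ Real.sqrt 2 * μ₀ * ε ^ (1 / (2 * (D : ℝ))) := h2ρ.trans hup
  rw [hρε] at hfin
  have hpos : 0 < Real.sqrt 2 * μ₀ * ε ^ (1 / (2 * (D : ℝ))) := by positivity
  linarith

end Summit.QuantumFields.QCD.Theorems.TiltedFlatnessNegative
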